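import Literature.Geometry.Kaehler.ComplexTorusCover
import Literature.Geometry.Kaehler.ComplexTorusMaps
import HarnessLib

/-!
# A complex torus is a complex Lie group

Companion of `Literature/Geometry/Kaehler/ComplexTorus.lean`, `ComplexTorusMaps.lean`,
`ComplexTorusCover.lean`. For complex tori `X = E/Φ(ℤ^ι)` (`ComplexTorus Φ`):

* `ComplexTorus.contMDiff_of_lift₂` — **two-variable lift criterion**: a map
  `F : X × X' → X''` of (products of) complex tori admitting a lift `G : E × E' → E''` to the
  universal covers (`F (π z, π' w) = π'' (G (z, w))`) which is `C^n` over `𝕜 ∈ {ℝ, ℂ}` is `C^n`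
  for the product manifold structure `𝓘(𝕜, E).prod 𝓘(𝕜, E')` on `X × X'` (in the product
  charts, whose inverses are `π × π'`, `F` reads as a lattice translate of `G`) — the
  two-variable form of `ComplexTorus.contMDiff_of_lift` (Lange–Birkenhake (1992), §1.1.2:
  maps of tori are studied through their lifts to the universal covers);
* `ComplexTorus.contMDiff_add`, `ComplexTorus.contMDiff_sub` — the group law
  `X × X → X`, `(x, y) ↦ x + y` (lift `(z, w) ↦ z + w`) and subtraction are `C^n` over
  `𝕜 ∈ {ℝ, ℂ}`, in particular holomorphic;
* `ComplexTorus.contMDiff_zsmul` — multiplication by `n ∈ ℤ` (the isogeny `n_X`) is `C^n`.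

So **a complex torus is a (compact, connected, commutative) complex Lie group**
(Lange–Birkenhake (1992), Ch. 1 §1: "a complex torus … is a connected compact complex Lie
group"; Mumford, *Abelian Varieties*, §1 (1)); the corresponding Mathlib instances
`LieAddGroup 𝓘(ℂ, E) ω (ComplexTorus Φ)` / `LieAddGroup 𝓘(ℝ, E) ∞ (ComplexTorus Φ)` are
registered in the sibling file `ComplexTorusLieGroupInstances.lean` (kept apart so that this
file holds theorems only). Everything is proved; no definition, no named fact. Translations and
negation (`contMDiff_add_const`, `contMDiff_neg`) are in `ComplexTorusMaps.lean`; the converse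
"a compact connected commutative complex Lie group is a complex torus" (Lange–Birkenhake
Lemma 1.1.1) is not addressed here.

## References

* H. Lange, Ch. Birkenhake, *Complex Abelian Varieties*, Grundlehren 302 (1992), Ch. 1 §1.1
  (complex tori as compact connected complex Lie groups), §1.1.2 (lifts to the universal
  covers). [LangeBirkenhake1992]
* D. Mumford, *Abelian Varieties* (1970), §1 (1). [MumfordAV1970]
-/

noncomputable section

open scoped Manifold ContDiff Topology
open Set Filter

namespace Literature.Geometry.Kaehler

namespace ComplexTorus

variable {ι ι' ι'' : Type*}
  {E E' E'' : Type*} [NormedAddCommGroup E] [NormedSpace ℂ E] [NormedAddCommGroup E']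
  [NormedSpace ℂ E'] [NormedAddCommGroup E''] [NormedSpace ℂ E'']
  {Φ : (ι → ℝ) ≃L[ℝ] E} {Φ' : (ι' → ℝ) ≃L[ℝ] E'} {Φ'' : (ι'' → ℝ) ≃L[ℝ] E''}

/-! ### Maps of two variables with a lift to the universal covers -/

section Lift₂

variable [Fintype ι] [Fintype ι'] [Fintype ι'']

omit [Fintype ι''] in
/-- A map `F : X × X' → X''` of complex tori admitting a continuous lift `G : E × E' → E''` to
the universal covers (`F (π z, π' w) = π'' (G (z, w))`) is continuous: over the product of two
chart domains it is `π'' ∘ G ∘ (φ × φ')`. Lange–Birkenhake (1992), §1.1.2 (lifts to the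
universal covers). [cite: LangeBirkenhake1992, §1.1.2] -/
theorem continuous_of_lift₂ {F : ComplexTorus Φ × ComplexTorus Φ' → ComplexTorus Φ''}
    {G : E × E' → E''} (hG : Continuous G)
    (h : ∀ z w, F (proj Φ (Φ.symm z), proj Φ' (Φ'.symm w)) = proj Φ'' (Φ''.symm (G (z, w)))) :
    Continuous F := by
  refine continuous_iff_continuousAt.2 fun t ↦ ?_
  have heq : (fun s : ComplexTorus Φ × ComplexTorus Φ' ↦
      proj Φ'' (Φ''.symm (G (chartAt E t.1 s.1, chartAt E' t.2 s.2)))) =ᶠ[𝓝 t] F := by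
    filter_upwards [((chartAt E t.1).open_source.prod (chartAt E' t.2).open_source).mem_nhds
      ⟨mem_chart_source E t.1, mem_chart_source E' t.2⟩] with s hs
    rw [← h, chartAt_eq, chartAt_eq, proj_symm_chart Φ hs.1, proj_symm_chart Φ' hs.2]
  refine ContinuousAt.congr ?_ heq
  have h1 : ContinuousAt (fun s : ComplexTorus Φ × ComplexTorus Φ' ↦ chartAt E t.1 s.1) t :=
    ((chartAt E t.1).continuousAt (mem_chart_source E t.1)).comp continuousAt_fst
  have h2 : ContinuousAt (fun s : ComplexTorus Φ × ComplexTorus Φ' ↦ chartAt E' t.2 s.2) t :=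
    ((chartAt E' t.2).continuousAt (mem_chart_source E' t.2)).comp continuousAt_snd
  exact ((continuous_proj Φ'').comp (Φ''.symm.continuous.comp hG)).continuousAt.comp
    (h1.prodMk h2)

/-- **A two-variable lifted map, written in the preferred product chart, is a lattice translate
of its lift**: if `F (π z, π' w) = π'' (G (z, w))` with `G` continuous, then near the centre of
the product chart at `t = (x, y)` (`(extChartAt x).prod (extChartAt y)`, whose inverse is
`π × π'`), the written map `(chart at F t) ∘ F ∘ (π × π')` is `w ↦ G w - c` for a lattice
constant `c = Φ''(n)`. [cite: LangeBirkenhake1992, §1.1.2] -/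
theorem writtenInExtChartAt_eventuallyEq_of_lift₂ {𝕜 : Type*} [NontriviallyNormedField 𝕜]
    [NormedSpace 𝕜 E] [NormedSpace 𝕜 E'] [NormedSpace 𝕜 E'']
    {F : ComplexTorus Φ × ComplexTorus Φ' → ComplexTorus Φ''} {G : E × E' → E''}
    (hG : Continuous G)
    (h : ∀ z w, F (proj Φ (Φ.symm z), proj Φ' (Φ'.symm w)) = proj Φ'' (Φ''.symm (G (z, w))))
    (t : ComplexTorus Φ × ComplexTorus Φ') :
    ∃ c : E'', (extChartAt 𝓘(𝕜, E'') (F t) ∘ F ∘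
        (extChartAt (𝓘(𝕜, E).prod 𝓘(𝕜, E')) t).symm) =ᶠ[𝓝 (extChartAt (𝓘(𝕜, E).prod 𝓘(𝕜, E')) t t)]
      fun w ↦ G w - c := by
  have hpt : extChartAt (𝓘(𝕜, E).prod 𝓘(𝕜, E')) t t =
      (chart Φ (corner Φ t.1) t.1, chart Φ' (corner Φ' t.2) t.2) := by
    rw [extChartAt_prod]
    simp [chartAt_eq]
  have hF : F (proj Φ (Φ.symm (chart Φ (corner Φ t.1) t.1)),
      proj Φ' (Φ'.symm (chart Φ' (corner Φ' t.2) t.2))) ∈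
        (chart Φ'' (corner Φ'' (F t))).source := by
    rw [proj_symm_chart Φ (by rw [← chartAt_eq]; exact mem_chart_source E t.1),
      proj_symm_chart Φ' (by rw [← chartAt_eq]; exact mem_chart_source E' t.2), Prod.mk.eta,
      ← chartAt_eq]
    exact mem_chart_source E'' (F t)
  rw [h, chart_source] at hF
  have hfun : (extChartAt 𝓘(𝕜, E'') (F t) ∘ F ∘ (extChartAt (𝓘(𝕜, E).prod 𝓘(𝕜, E')) t).symm) =
      fun w ↦ chart Φ'' (corner Φ'' (F t)) ((chart Φ'' (corner Φ'' (F t))).symm (G w)) := by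
    funext w
    rw [extChartAt_prod]
    simp [chartAt_eq, h]
  refine ⟨Φ'' (fun i ↦ (toIcoDiv zero_lt_one (corner Φ'' (F t) i)
    (Φ''.symm (G (chart Φ (corner Φ t.1) t.1, chart Φ' (corner Φ' t.2) t.2)) i) : ℝ)), ?_⟩
  rw [hfun, hpt]
  exact (eventuallyEq_chart_symm_trans Φ'' hF (corner Φ'' (F t))).comp_tendsto hG.continuousAt

/-- **Two-variable lift criterion: maps of products of complex tori with a `C^n` lift are
`C^n`.** If `F : E/Φ(ℤ^ι) × E'/Φ'(ℤ^ι') → E''/Φ''(ℤ^ι'')` satisfies `F (π z, π' w) = π'' (G (z, w))`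
for a map `G : E × E' → E''` which is `C^n` over `𝕜` (`𝕜 = ℂ`: holomorphic; `𝕜 = ℝ`: real
`C^n`), then `F` is `C^n` as a map of manifolds modelled on `𝓘(𝕜, E).prod 𝓘(𝕜, E')`,
`𝓘(𝕜, E'')` (in the product charts it is a lattice translate of `G`,
`writtenInExtChartAt_eventuallyEq_of_lift₂`). Two-variable form of `contMDiff_of_lift`.
[cite: LangeBirkenhake1992, §1.1.2] -/
theorem contMDiff_of_lift₂ {𝕜 : Type*} [NontriviallyNormedField 𝕜] [NormedSpace 𝕜 E]
    [NormedSpace 𝕜 E'] [NormedSpace 𝕜 E''] {n : WithTop ℕ∞}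
    {F : ComplexTorus Φ × ComplexTorus Φ' → ComplexTorus Φ''} {G : E × E' → E''}
    (hG : ContDiff 𝕜 n G)
    (h : ∀ z w, F (proj Φ (Φ.symm z), proj Φ' (Φ'.symm w)) = proj Φ'' (Φ''.symm (G (z, w)))) :
    ContMDiff (𝓘(𝕜, E).prod 𝓘(𝕜, E')) 𝓘(𝕜, E'') n F := by
  intro t
  refine contMDiffAt_iff.2 ⟨(continuous_of_lift₂ hG.continuous h).continuousAt, ?_⟩
  obtain ⟨c, hc⟩ := writtenInExtChartAt_eventuallyEq_of_lift₂ (𝕜 := 𝕜) hG.continuous h t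
  exact ((hG.contDiffAt.sub contDiffAt_const).congr_of_eventuallyEq hc).contDiffWithinAt

end Lift₂

/-! ### The group law -/

section Group

variable [Fintype ι]

/-- **The group law of a complex torus is `C^n`** (over `𝕜 ∈ {ℝ, ℂ}`, for every `n`; in
particular holomorphic) as a map `X × X → X` on the product manifold: its lift to the universal
covers is the addition `(z, w) ↦ z + w` of `E`. Lange–Birkenhake (1992), Ch. 1 §1.1 ("a complex
torus … is a connected compact complex Lie group"). [cite: LangeBirkenhake1992, §1.1.1] -/
theorem contMDiff_add {𝕜 : Type*} [NontriviallyNormedField 𝕜] [NormedSpace 𝕜 E]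
    {n : WithTop ℕ∞} :
    ContMDiff (𝓘(𝕜, E).prod 𝓘(𝕜, E)) 𝓘(𝕜, E) n
      (fun p : ComplexTorus Φ × ComplexTorus Φ ↦ p.1 + p.2) :=
  contMDiff_of_lift₂ (G := fun q : E × E ↦ q.1 + q.2) (contDiff_fst.add contDiff_snd)
    fun z w ↦ by rw [map_add, proj_add]

/-- Subtraction `X × X → X`, `(x, y) ↦ x - y`, is `C^n` over `𝕜 ∈ {ℝ, ℂ}` (lift
`(z, w) ↦ z - w`). [cite: LangeBirkenhake1992, §1.1.1] -/
theorem contMDiff_sub {𝕜 : Type*} [NontriviallyNormedField 𝕜] [NormedSpace 𝕜 E]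
    {n : WithTop ℕ∞} :
    ContMDiff (𝓘(𝕜, E).prod 𝓘(𝕜, E)) 𝓘(𝕜, E) n
      (fun p : ComplexTorus Φ × ComplexTorus Φ ↦ p.1 - p.2) :=
  contMDiff_of_lift₂ (G := fun q : E × E ↦ q.1 - q.2) (contDiff_fst.sub contDiff_snd)
    fun z w ↦ by
      rw [map_sub, sub_eq_add_neg, sub_eq_add_neg, proj_add]
      rfl

/-- Multiplication by an integer `n`, `x ↦ n • x` (the isogeny `n_X` for `n ≠ 0`), is `C^n` over
`𝕜 ∈ {ℝ, ℂ}` (lift `z ↦ n • z`). Lange–Birkenhake (1992), §1.1.2 (the homomorphism `n_X`).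
[cite: LangeBirkenhake1992, §1.1.2] -/
theorem contMDiff_zsmul {𝕜 : Type*} [NontriviallyNormedField 𝕜] [NormedSpace 𝕜 E]
    {n : WithTop ℕ∞} (m : ℤ) :
    ContMDiff 𝓘(𝕜, E) 𝓘(𝕜, E) n (fun x : ComplexTorus Φ ↦ m • x) :=
  contMDiff_of_lift (G := fun z : E ↦ (m : 𝕜) • z) (contDiff_id.const_smul (m : 𝕜)) fun z ↦ by
    rw [Int.cast_smul_eq_zsmul, map_zsmul]
    funext i
    change m • (((Φ.symm z i : ℝ)) : AddCircle (1 : ℝ)) = (((m • Φ.symm z i : ℝ)) : AddCircle (1 : ℝ))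
    rw [AddCircle.coe_zsmul]

end Group

end ComplexTorus

end Literature.Geometry.Kaehler
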